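import Mathlib

set_option linter.dupNamespace false

/-!
# Gordan potentials force constant-type injective row families to be local chart-USPs

Stub `stub_rigidClassUSP` of the line `tame-charts` for the crux
`Summit.MatrixMultiplication.MatrixMultiplication.Theses.ThinBlockAlpha.BoundedExponentThird`.

A *chart* assigns to every symbol `x : Fin k` three finite subsets `SA x, SB x, SC x` of an additive
abelian group `Z`.  The symbol pattern `(x, y, z)` is *bad* when
`∃ s' ∈ SA x, ∃ s ∈ SA z, ∃ t' ∈ SB y, ∃ t ∈ SB x, ∃ u' ∈ SC z, ∃ u ∈ SC y,
(s' - s) + (t' - t) + (u' - u) = 0`.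
The hypothesis `hR` is a Gordan-type rigidity certificate: integer potentials `φ₁ φ₂ φ₃` on the
symbols with `φ₁ + φ₂ + φ₃ ≡ 0` and `φ₁ x + φ₂ y + φ₃ z > 0` on every bad off-diagonal pattern.

Claim (`stub_rigidClassUSP`): an injective family of rows `row i : Fin n → Fin k`, all of the same
type `μ` (the letter `x` occurs `μ x` times in every row), is a local chart-USP: every index triple
`(i, j, l)` which is not constant has a coordinate `c` whose pattern `(row i c, row j c, row l c)` is
not bad.

Proof: assume every coordinate is bad and put `w c := φ₁ (row i c) + φ₂ (row j c) + φ₃ (row l c)`.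
Regrouping each of the three sums by the value of the row (all rows have type `μ`) gives
`∑ c, w c = ∑ x, μ x • (φ₁ x + φ₂ x + φ₃ x) = 0`.  Each `w c` is `≥ 0`: on a diagonal coordinate it is
`(φ₁ + φ₂ + φ₃) (row i c) = 0`, and on an off-diagonal (bad) coordinate it is `> 0` by `hR`.  Hence all
`w c = 0`, so every coordinate is diagonal, so `row i = row j = row l`, so `i = j = l` by injectivity,
contradicting the hypothesis on `(i, j, l)`.
-/

namespace Summit.MatrixMultiplication.MatrixMultiplication.Theorems.BoundedExponentThird.TameCharts

/-- Regrouping a sum over the coordinates of a row by letters: if the letter `x` occurs `μ x` times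
in the row `r`, then `∑ c, g (r c) = ∑ x, μ x • g x`. -/
private theorem stub_rigidClassUSP_sum_fiber {k n : ℕ} (r : Fin n → Fin k) (μ : Fin k → ℕ)
    (hr : ∀ x, (Finset.univ.filter fun c => r c = x).card = μ x) (g : Fin k → ℤ) :
    ∑ c, g (r c) = ∑ x, μ x • g x := by
  rw [← Finset.sum_fiberwise' Finset.univ r g]
  refine Finset.sum_congr rfl fun x _ => ?_
  rw [Finset.sum_const, hr x]

/-- **Gordan potentials ⟹ constant-type classes are local chart-USPs.**  If integer potentials
`φ₁ φ₂ φ₃` with `φ₁ + φ₂ + φ₃ ≡ 0` are strictly positive on every bad off-diagonal symbol pattern,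
then every injective family of rows of one and the same type `μ` is a local chart-USP: each
non-constant index triple `(i, j, l)` has a coordinate whose symbol pattern
`(row i c, row j c, row l c)` is not bad. -/
theorem stub_rigidClassUSP
    (Z : Type) [AddCommGroup Z] (k : ℕ) (SA SB SC : Fin k → Finset Z)
    (hR : ∃ φ₁ φ₂ φ₃ : Fin k → ℤ, (∀ x, φ₁ x + φ₂ x + φ₃ x = 0) ∧
      ∀ x y z : Fin k,
        (∃ s' ∈ SA x, ∃ s ∈ SA z, ∃ t' ∈ SB y, ∃ t ∈ SB x, ∃ u' ∈ SC z, ∃ u ∈ SC y,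
          (s' - s) + (t' - t) + (u' - u) = 0) →
        ¬ (x = y ∧ y = z) → 0 < φ₁ x + φ₂ y + φ₃ z)
    (n L : ℕ) (μ : Fin k → ℕ) (row : Fin L → Fin n → Fin k) (hinj : Function.Injective row)
    (htype : ∀ i x, (Finset.univ.filter fun c => row i c = x).card = μ x) :
    ∀ i j l : Fin L, ¬ (i = j ∧ j = l) → ∃ c : Fin n,
      ¬ ∃ s' ∈ SA (row i c), ∃ s ∈ SA (row l c), ∃ t' ∈ SB (row j c), ∃ t ∈ SB (row i c),
          ∃ u' ∈ SC (row l c), ∃ u ∈ SC (row j c), (s' - s) + (t' - t) + (u' - u) = 0 := by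
  obtain ⟨φ₁, φ₂, φ₃, hsum, hpos⟩ := hR
  intro i j l hijl
  by_contra hcon
  -- every coordinate carries a bad pattern
  have hall := fun c => of_not_not (not_exists.mp hcon c)
  set w : Fin n → ℤ := fun c => φ₁ (row i c) + φ₂ (row j c) + φ₃ (row l c) with hw
  have hw_nonneg : ∀ c, 0 ≤ w c := by
    intro c
    by_cases hd : row i c = row j c ∧ row j c = row l c
    · obtain ⟨h1, h2⟩ := hd
      change 0 ≤ φ₁ (row i c) + φ₂ (row j c) + φ₃ (row l c)
      rw [h1, h2, hsum]
    · exact (hpos _ _ _ (hall c) hd).le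
  have hw_sum : ∑ c, w c = 0 := by
    simp only [hw, Finset.sum_add_distrib]
    rw [stub_rigidClassUSP_sum_fiber (row i) μ (htype i) φ₁,
      stub_rigidClassUSP_sum_fiber (row j) μ (htype j) φ₂,
      stub_rigidClassUSP_sum_fiber (row l) μ (htype l) φ₃,
      ← Finset.sum_add_distrib, ← Finset.sum_add_distrib]
    refine Finset.sum_eq_zero fun x _ => ?_
    rw [← smul_add, ← smul_add, hsum x, smul_zero]
  have hw_zero : ∀ c, w c = 0 := fun c =>
    (Finset.sum_eq_zero_iff_of_nonneg fun c _ => hw_nonneg c).1 hw_sum c (Finset.mem_univ c)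
  have hdiag : ∀ c, row i c = row j c ∧ row j c = row l c := by
    intro c
    by_contra hd
    exact (hpos _ _ _ (hall c) hd).ne' (hw_zero c)
  exact hijl ⟨hinj (funext fun c => (hdiag c).1), hinj (funext fun c => (hdiag c).2)⟩

end Summit.MatrixMultiplication.MatrixMultiplication.Theorems.BoundedExponentThird.TameCharts
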